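import Summits.BirchSwinnertonDyer.BirchSwinnertonDyer.Theorems.ManinLocalTwoThreeTwoShiftEqualiser
import Summits.BirchSwinnertonDyer.BirchSwinnertonDyer.Theorems.ManinLocalTwoThreeTwoShiftTransferStep
import Mathlib.Algebra.CharP.Two
import HarnessLib

/-!
# The 2-ADIC TWIN, VI: G₂ `TwoShiftInvariantIsDiamond` and G₈ `EightShiftInvariantIsDiamond` are THEOREMS at every level
# (route `ManinLocalTwoThree`, cell bsd-f2-manin; crux C2 `ManinOddAtFour` stmt-BirchSwinnertonDyer-22967; prover seat p3 gen 11 +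
# LEAD p1 gen 12)

UNCONDITIONAL ASSEMBLY.  The one node `TwoShiftCubeStep` of file V (the index-3 descent `Γ₀(2N₀) → Γ₀(N₀)`, `N₀` odd, for additive
`ε`-eigenfunctions of the 2-shift into a field of characteristic `2`, `ε ≠ 0`) is DISCHARGED by the LEAD's transfer theorem
`TwoShiftTransfer.transfer_descent` (`…TwoShiftTransferStep.lean`, p1 g12 — the `p = 2` port of the seat's `…CubeStep.lean`: transfer
of the coshift from the index-3 stabiliser `Stab(0)` of `P¹(𝔽₂)`, `3 = 1` in `K`).  Hence, with the seat's files I–V (vocabulary,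
descent engine `Γ₀(4m) → Γ₀(2m)`, the 2-power tower with the `χ₄`/`χ₈` absorbers, the ω-part with the explicit `χ₄`/`χ₈` pairs, the
ω-reduction over `𝔽₄`, p2's rigidity base at odd level):
* **`twoShiftInvariantIsDiamond_holds : TwoShiftInvariantIsDiamond`** — G₂, the `p = 2` twin of es's E-es-96: for EVERY `N ≥ 1`,
  every additive `φ : Γ₀(N) → 𝔽₂` invariant under `γ ↦ diag(2,1) γ diag(2,1)⁻¹` on `Γ₀(2N)` vanishes on `Γ₁(N)` (`K₂(N) = D(N)`:
  the degeneracy-equaliser / Ihara-type statement with trivial mod-2 coefficients at levels divisible by `2`, Eisenstein part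
  included);
* **`eightShiftInvariantIsDiamond_holds : EightShiftInvariantIsDiamond`** — G₈, the twin of E-es-94♯ with the ratio `t = 8` of the C2
  consumer `twoAdicPolarWitness_of_degeneracyEightPlusIndex` (`K₈(N) = D(N)` for every `N ≥ 1`).
CENSUS (seat engine HOME/p3/g11/rs_equaliser.py 7b756abc8880dce9, table TWOSHIFT-CENSUS-p3-g11.txt: Reidemeister–Schreier over `𝔽₂`,
validated against es ENGINE 4 at `p = 3`): `dim K₈(N) = r₂((ℤ/N)ˣ)` at all `4 ∣ N ≤ 48` and all `N ≤ 15`, `dim K₂(N) = r₂` at all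
`N ≤ 35`, ω-part `0` at all `M ≤ 32` — now theorems at every level.  Axioms standard.  HONEST FRAMING: nothing about BSD, Manin's
conjecture or C2 is proved by this; the C2 consequence of G₈ on the squarefull `4 ∣ N` cell (via a ratio-8 conjugation-defect law) is
anyway covered by the tree's E-es-66₂ `twoAdicWitnessOfPlusIndexOdd_holds`; the value is the structure theorem.
Reference: HOME/MEMO-es.md §37 (the `p = 3` chain) [cite: DarmonDiamondTaylor1995, Lemma 4.28 (p. 135) (shape: degeneracy maps)].
-/

set_option autoImplicit false
set_option linter.dupNamespace false

namespace Summit.BirchSwinnertonDyer.BirchSwinnertonDyer.Theorems.ManinLocalTwoThree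

namespace TwoShift

/-- **THE NODE HOLDS** (LEAD p1's transfer theorem `TwoShiftTransfer.transfer_descent` in the node's shape: field of characteristic
`2`, `ε ≠ 0` is a unit). [new at `p = 2`: transfer from the index-3 stabiliser, p1 g12] -/
theorem twoShiftCubeStep_holds : TwoShiftCubeStep := by
  intro K _ _ ε hε0 N₀ _ hodd η hadd hinv
  exact TwoShiftTransfer.transfer_descent CharTwo.two_eq_zero hodd η ε (isUnit_iff_ne_zero.mpr hε0) hadd hinv

/-- **G₂ — THE `p = 2` TWIN OF E-es-96, A THEOREM AT EVERY LEVEL** (`K₂(N) = D(N)` for all `N ≥ 1`).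
[new: cell bsd-f2-manin — seat p3 g11 (engine, tower, ω-part, assembly) + LEAD p1 g12 (index-3 transfer) + p2 g12 (odd-level base)] -/
theorem twoShiftInvariantIsDiamond_holds : TwoShiftInvariantIsDiamond :=
  twoShiftInvariantIsDiamond_of_cube twoShiftCubeStep_holds

/-- **G₈ — THE `p = 2` TWIN OF E-es-94♯ (ratio `t = 8`), A THEOREM AT EVERY LEVEL** (`K₈(N) = D(N)` for all `N ≥ 1`).
[new: cell bsd-f2-manin — seat p3 g11 + LEAD p1 g12 + p2 g12] -/
theorem eightShiftInvariantIsDiamond_holds : EightShiftInvariantIsDiamond :=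
  eightShiftInvariantIsDiamond_of_cube twoShiftCubeStep_holds

/-- the ω-part vanishes at EVERY level: every additive `ε`-eigenfunction of the 2-shift `Γ₀(N) → K` (`K` a field of characteristic
`2` in `Type`, `ε ≠ 0, 1`) is zero. [new] -/
theorem shiftEigenTrivialAt_holds {K : Type} [Field K] [CharP K 2] (ε : K) (hε0 : ε ≠ 0) (hε1 : ε ≠ 1) (N : ℕ) (hN : 0 < N) :
    ShiftEigenTrivialAt N ε :=
  shiftEigenTrivialAt_of_cube twoShiftCubeStep_holds ε hε0 hε1 N hN

end TwoShift

end Summit.BirchSwinnertonDyer.BirchSwinnertonDyer.Theorems.ManinLocalTwoThree
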